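import Summits.ResolutionOfSingularities.ResolutionOfSingularities.Theorems.EquisingularLiftEquisingularLiftNatCrossedLetterTransport
import HarnessLib

/-!
# [OURS · L1 W4.5(b) · EL♮(3) · WIDTH TABLE D5, supplier row HOPEN, input (IN-4)] THE CROSSED LETTER WITH ITS MODEL, IN HOPEN'S BINDER SHAPE
# `TCPlus.crossedLetter_clauses' k : <(IN-4) hCLw of TCPlus.hopen_supplier_of (⊙ p673006), verbatim>` — a re-spelling of res-L1-w45b-stub-4's ✓ `TCPlus.crossedLetter_clauses`

res-L1-w45b-stub-2 g16.  OURS; NOT a statement of any manuscript ([Hironaka2017] is a candidate under adjudication, nothing of it is asserted); AI-written,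
weaker than expert review.  No `sorry`; standard axioms; DEF-FREE.  `--supports stmt-ResolutionOfSingularities-20148 --as helper`.

WHAT.  res-L1-w45b-stub-4's ✓ `TCPlus.crossedLetter_clauses` (…NatCrossedLetterTransport, p672159) — the five `LetterDatum` clauses of the strict transform of a
letter crossing the centre transversally, with the model `strictTransformIdeal τ C 𝓛` explicit — restated in the ARGUMENT ORDER of HOPEN's (IN-4) binder (HPAIR's
`hCL` order with the model explicit; three unused binders: the centre's 2-frames, its off-`Y` clause, `G` regular at closed points of `Z`) and with the trace written
`𝓘⟨closure (closure (υ₂⁻¹(closure L ∖ Z)))⟩` (one `closure_closure`). [folklore; pure re-spelling]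
-/

set_option linter.dupNamespace false
set_option linter.overlappingInstances false

noncomputable section

open CategoryTheory CategoryTheory.Limits AlgebraicGeometry TopologicalSpace Topology IsLocalRing
open Literature.AlgebraicGeometry.Resolution AlgebraicGeometry.Scheme.IdealSheafData
open Summit.ResolutionOfSingularities.ResolutionOfSingularities.Theses.EquisingularLift.Split
open Summit.ResolutionOfSingularities.ResolutionOfSingularities.Cruxes.EquisingularLift.StrataSplit

namespace Summit.ResolutionOfSingularities.ResolutionOfSingularities.Cruxes.EquisingularLiftNat.Sections

/-- **(IN-4) in HOPEN's binder shape** — see the module docstring. [OURS · L1 W4.5b · pure re-spelling of ✓ `TCPlus.crossedLetter_clauses`] -/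
theorem TCPlus.crossedLetter_clauses' (k : Type) [Field k] :
    ∀ (O : Type) [CommRing O] [IsDomain O] [IsDiscreteValuationRing O] (θ : O →+* k), Function.Surjective θ →
      ∀ {P X X₂ G G₂ : AlgebraicGeometry.Scheme.{0}} (q : P ⟶ AlgebraicGeometry.Spec (.of O)) (Y : Set P) (σ : X ⟶ P)
        [IsLocallyNoetherian X] [AlgebraicGeometry.IsIntegral X] [IsLocallyNoetherian X₂] [AlgebraicGeometry.IsIntegral X₂]
        [IsLocallyNoetherian G] [AlgebraicGeometry.IsIntegral G] [IsLocallyNoetherian G₂] [AlgebraicGeometry.IsIntegral G₂] [AlgebraicGeometry.IsProper (σ ≫ q)],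
        Literature.AlgebraicGeometry.Resolution.Scheme.IsRegular X → Literature.AlgebraicGeometry.Resolution.Scheme.IsRegular X₂ →
      ∀ (jG : G ⟶ X) (tG : G ⟶ AlgebraicGeometry.Spec (.of k)), IsPullback jG tG (σ ≫ q) (AlgebraicGeometry.Spec.map (CommRingCat.ofHom θ)) →
      -- the centre: a regular `O`-flat relative curve with reduced trace `𝓘⟨Z⟩`, 2-frames, off `Y`; downstairs `Z̃` regular, a curve, `G` regular along `Z`
      ∀ (C : X.IdealSheafData) (Z : Set G) (hZ : IsClosed Z),
        C.comap jG = AlgebraicGeometry.Scheme.IdealSheafData.vanishingIdeal (⟨Z, hZ⟩ : TopologicalSpace.Closeds G) → AlgebraicGeometry.Flat (C.subschemeι ≫ σ ≫ q) →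
        Literature.AlgebraicGeometry.Resolution.Scheme.IsRegular C.subscheme → C ≠ ⊥ →
        (∀ x ∈ C.support, ∃ c : Fin 2 → X.presheaf.stalk x, Ideal.span (Set.range c) = Literature.AlgebraicGeometry.Resolution.stalkIdeal C x ∧ IsQuasiRegular c) →
        σ '' (C.support : Set X) ⊆ {p : P | ¬ IsGenericPoint p Y} →
        (∀ z : ↥(redSub G Z hZ), IsRegularLocalRing ((redSub G Z hZ).presheaf.stalk z)) →
        (∀ z : ↥(redSub G Z hZ), IsClosed ({z} : Set ↥(redSub G Z hZ)) → ringKrullDim ((redSub G Z hZ).presheaf.stalk z) = ((1 : ℕ) : WithBot ℕ∞)) →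
        (∀ z ∈ Z, IsClosed ({z} : Set G) → IsRegularLocalRing (G.presheaf.stalk z)) →
      -- the round upstairs and downstairs, the new model square
      ∀ {τ : X₂ ⟶ X}, Literature.AlgebraicGeometry.Resolution.IsBlowup τ C →
      ∀ {υ₂ : G₂ ⟶ G}, Literature.AlgebraicGeometry.Resolution.IsBlowup υ₂ (AlgebraicGeometry.Scheme.IdealSheafData.vanishingIdeal (⟨Z, hZ⟩ : TopologicalSpace.Closeds G)) →
      ∀ (j₂ : G₂ ⟶ X₂) (t₂ : G₂ ⟶ AlgebraicGeometry.Spec (.of k)), IsPullback j₂ t₂ ((τ ≫ σ) ≫ q) (AlgebraicGeometry.Spec.map (CommRingCat.ofHom θ)) → j₂ ≫ τ = υ₂ ≫ jG →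
      -- (CL) a listed letter NOT containing the centre and meeting it transversally (possibly not at all) steps to its strict transform
      ∀ (L : Set G) (𝓛 : X.IdealSheafData), 𝓛.comap jG = vanishingIdeal (⟨closure L, isClosed_closure⟩ : Closeds G) → (∀ z : X, (stalkIdeal 𝓛 z).IsPrincipal) →
        Scheme.IsRegular 𝓛.subscheme → σ '' (𝓛.support : Set X) ⊆ {p : P | ¬ IsGenericPoint p Y} → Flat (𝓛.subschemeι ≫ σ ≫ q) →
        AlgebraicGeometry.Scheme.IdealSheafData.vanishingIdeal (⟨closure L, isClosed_closure⟩ : TopologicalSpace.Closeds G) ⊔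
            AlgebraicGeometry.Scheme.IdealSheafData.vanishingIdeal (⟨Z, hZ⟩ : TopologicalSpace.Closeds G) =
          AlgebraicGeometry.Scheme.IdealSheafData.vanishingIdeal (⟨closure L ∩ Z, isClosed_closure.inter hZ⟩ : TopologicalSpace.Closeds G) →
        (∀ z ∈ Z, IsClosed ({z} : Set G) →
          ¬ Literature.AlgebraicGeometry.Resolution.stalkIdeal (AlgebraicGeometry.Scheme.IdealSheafData.vanishingIdeal (⟨closure L, isClosed_closure⟩ : TopologicalSpace.Closeds G)) z ≤
            Literature.AlgebraicGeometry.Resolution.stalkIdeal (AlgebraicGeometry.Scheme.IdealSheafData.vanishingIdeal (⟨Z, hZ⟩ : TopologicalSpace.Closeds G)) z) →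
        ((strictTransformIdeal τ C 𝓛).comap j₂ = vanishingIdeal (⟨closure (closure (υ₂ ⁻¹' (closure L \ Z))), isClosed_closure⟩ : Closeds G₂) ∧
          (∀ z : X₂, (stalkIdeal (strictTransformIdeal τ C 𝓛) z).IsPrincipal) ∧ Scheme.IsRegular (strictTransformIdeal τ C 𝓛).subscheme ∧
          (τ ≫ σ) '' ((strictTransformIdeal τ C 𝓛).support : Set X₂) ⊆ {p : P | ¬ IsGenericPoint p Y} ∧ Flat ((strictTransformIdeal τ C 𝓛).subschemeι ≫ (τ ≫ σ) ≫ q)) := by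
  intro O _ _ _ θ hθ P X X₂ G G₂ q Y σ _ _ _ _ _ _ _ _ _ hX hX₂ jG tG hsq C Z hZ hCZ hCfl hCreg hC0 _ _ hZreg hZdim _ τ hτ υ₂ hυ₂ j₂ t₂ hsq₂ hcomm
    L 𝓛 hl1 hl2 hl3 hl4 hl5 htr hnc
  obtain ⟨h1, h2, h3, h4, h5⟩ := TCPlus.crossedLetter_clauses k O θ hθ q Y σ hX hX₂ jG tG hsq C hZ hCZ hCfl hCreg hC0 hZreg hZdim hτ hυ₂ j₂ t₂ hsq₂
    hcomm L 𝓛 hl1 hl2 hl3 hl4 hl5 htr hnc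
  refine ⟨?_, h2, h3, h4, h5⟩
  rw [h1]; congr 1; exact Closeds.ext closure_closure.symm

end Summit.ResolutionOfSingularities.ResolutionOfSingularities.Cruxes.EquisingularLiftNat.Sections

end
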